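import Mathlib.Analysis.Complex.Exponential
import Mathlib.Analysis.SpecialFunctions.Log.Basic
import Mathlib.RingTheory.Radical.NatInt
import Mathlib.Order.Interval.Finset.Nat
import HarnessLib

/-!
# An elementary lower bound for the log-radical: `Σ_{p ∈ S} log p ≥ n·(log n − 1)` for `n` distinct primes

R-H lane support file (abc-iut cell; rung LADDER-ABC:A2.RESCUE.H), PROOF-ONLY, pure elementary real analysis / counting —
it mentions no IUT object, TAKES NO SIDE on [IUTchIII] Cor. 3.12 or on any author, and asserts nothing about abc.

PURPOSE. The R-H round-2 instrument «window-entry class» (abc-iut-lens-strengthen-3 g3, staging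
`HOME/staging/RH/lens-strengthen-3/WindowEntryClass.lean`, theorem
`windowEntryContentLaw_of (hR : RosserRadicalLower) (hmono : …)`) carries two hypothesis BINDERS, recorded in
`plan/GAP-LEDGER.md` row G-lens-strengthen-3-1 as an explicit «Rosser bound»:

* `RosserRadicalLower := ∀ S : Finset ℕ, (∀ p ∈ S, Nat.Prime p) →
    (S.card : ℝ) * (Real.log (S.card : ℝ) - 1) ≤ ∑ p ∈ S, Real.log (p : ℝ)`,
* `hmono : ∀ a b : ℝ, 1 ≤ a → a ≤ b → a * (Real.log a - 1) ≤ b * (Real.log b - 1)`.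

BOTH ARE ELEMENTARY THEOREMS, proved here with no prime number theory at all (so the instrument's explicit clause needs no
published constant): for a finite set `S` of `n` distinct primes — indeed of `n` distinct POSITIVE integers —

  `∏_{x ∈ S} x ≥ n!`   (the `k`-th smallest element is `≥ k`)   and   `n! ≥ (n/e)^n`   (`e^n ≥ n^n/n!`),

hence `Σ_{x ∈ S} log x ≥ log n! ≥ n log n − n = n (log n − 1)` (`forall_card_mul_log_card_sub_one_le_sum_log_of_prime` has
LITERALLY the type of `RosserRadicalLower`'s body; `mul_log_sub_one_le_mul_log_sub_one` has literally the type of `hmono`).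
NOTE ON STRENGTH: the input usually quoted, Rosser's theorem `p_k > k log k` (Rosser 1939; Rosser–Schoenfeld 1962 (3.12)),
gives `Σ_{k ≤ n} log p_k ≥ log n! + Σ_{k ≤ n} log log k`; the bound here drops the `Σ log log k` gain and therefore needs
only the Stirling floor `log n! ≥ n log n − n` (Mathlib `Real.pow_div_factorial_le_exp`) and distinctness. In radical
language: `ω(n)·(log ω(n) − 1) ≤ log rad(n) ≤ log n` (`card_primeFactors_mul_log_sub_one_le_log_radical`, `…_le_log`).

Everything here is [folklore] (elementary). No `sorry`, standard axioms.
-/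

open Finset

namespace Summit.ABC.IUTFork.Repair.RH.LogRadicalFloor

/-! ## 1. The Stirling floor `n (log n − 1) ≤ log n!` -/

/-- Stirling floor: `n·(log n − 1) ≤ log n!` for every natural `n` (from `n^n/n! ≤ e^n`, Mathlib
`Real.pow_div_factorial_le_exp`). [folklore] -/
theorem natCast_mul_log_sub_one_le_log_factorial (n : ℕ) :
    (n : ℝ) * (Real.log (n : ℝ) - 1) ≤ Real.log ((n.factorial : ℕ) : ℝ) := by
  rcases Nat.eq_zero_or_pos n with rfl | hn
  · simp
  have hfac : (0 : ℝ) < ((n.factorial : ℕ) : ℝ) := by exact_mod_cast Nat.factorial_pos n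
  have hnpos : (0 : ℝ) < (n : ℝ) := by exact_mod_cast hn
  have h : (n : ℝ) ^ n / ((n.factorial : ℕ) : ℝ) ≤ Real.exp (n : ℝ) :=
    Real.pow_div_factorial_le_exp (x := (n : ℝ)) (Nat.cast_nonneg n) n
  have h1 : (n : ℝ) ^ n ≤ Real.exp (n : ℝ) * ((n.factorial : ℕ) : ℝ) := by
    rwa [div_le_iff₀ hfac] at h
  have h2 : Real.log ((n : ℝ) ^ n) ≤ Real.log (Real.exp (n : ℝ) * ((n.factorial : ℕ) : ℝ)) :=
    Real.log_le_log (pow_pos hnpos n) h1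
  rw [Real.log_pow, Real.log_mul (Real.exp_pos _).ne' hfac.ne', Real.log_exp] at h2
  linarith

/-! ## 2. Counting: `(#S)! ≤ ∏ S` for a finite set of positive naturals -/

/-- For a finite set `S` of POSITIVE natural numbers, `(#S)! ≤ ∏_{x ∈ S} x`: inserting a new maximum `a` into a set
`s ⊆ [1, a)` multiplies the product by `a ≥ #s + 1`. [folklore] -/
theorem factorial_card_le_prod (S : Finset ℕ) (hS : ∀ x ∈ S, 1 ≤ x) :
    (S.card).factorial ≤ ∏ x ∈ S, x := by
  induction S using Finset.induction_on_max with
  | empty => simp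
  | insert a s hlt ih =>
    have ha : a ∉ s := fun h => lt_irrefl a (hlt a h)
    have hs1 : ∀ x ∈ s, 1 ≤ x := fun x hx => hS x (Finset.mem_insert_of_mem hx)
    have ha1 : 1 ≤ a := hS a (Finset.mem_insert_self a s)
    have hsub : s ⊆ Finset.Ico 1 a := by
      intro x hx
      rw [Finset.mem_Ico]
      exact ⟨hs1 x hx, hlt x hx⟩
    have hcard : s.card + 1 ≤ a := by
      have hle := Finset.card_le_card hsub
      rw [Nat.card_Ico] at hle
      omega
    rw [Finset.card_insert_of_notMem ha, Finset.prod_insert ha, Nat.factorial_succ]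
    exact Nat.mul_le_mul hcard (ih hs1)

/-! ## 3. The log-radical lower bound -/

/-- For a finite set `S` of positive naturals: `#S·(log #S − 1) ≤ Σ_{x ∈ S} log x`. [folklore] -/
theorem card_mul_log_card_sub_one_le_sum_log {S : Finset ℕ} (hS : ∀ x ∈ S, 1 ≤ x) :
    (S.card : ℝ) * (Real.log (S.card : ℝ) - 1) ≤ ∑ x ∈ S, Real.log (x : ℝ) := by
  have h1 := natCast_mul_log_sub_one_le_log_factorial S.card
  have h2 : Real.log (((S.card).factorial : ℕ) : ℝ) ≤ Real.log ((∏ x ∈ S, x : ℕ) : ℝ) := by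
    apply Real.log_le_log (by exact_mod_cast Nat.factorial_pos _)
    exact_mod_cast factorial_card_le_prod S hS
  have h3 : Real.log ((∏ x ∈ S, x : ℕ) : ℝ) = ∑ x ∈ S, Real.log (x : ℝ) := by
    rw [Nat.cast_prod, Real.log_prod]
    intro x hx
    exact_mod_cast Nat.one_le_iff_ne_zero.mp (hS x hx)
  rw [h3] at h2
  exact le_trans h1 h2

/-- For a finite set `S` of primes: `#S·(log #S − 1) ≤ Σ_{p ∈ S} log p` — the explicit lower bound for the log-radical of
`#S` distinct primes, WITHOUT any prime number theory (cf. Rosser 1939 `p_k > k log k`, which gives a slightly better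
bound with an extra `Σ log log k`). [folklore] -/
theorem card_mul_log_card_sub_one_le_sum_log_of_prime {S : Finset ℕ} (hS : ∀ p ∈ S, Nat.Prime p) :
    (S.card : ℝ) * (Real.log (S.card : ℝ) - 1) ≤ ∑ p ∈ S, Real.log (p : ℝ) :=
  card_mul_log_card_sub_one_le_sum_log fun p hp => (hS p hp).one_lt.le

/-- The same bound in the packaged `∀`-shape
`∀ S : Finset ℕ, (∀ p ∈ S, Nat.Prime p) → (S.card : ℝ) * (Real.log (S.card : ℝ) - 1) ≤ ∑ p ∈ S, Real.log (p : ℝ)`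
— literally the body of the binder `RosserRadicalLower` of GAP row G-lens-strengthen-3-1, so a hypothesis of exactly that
shape is discharged by this term. [folklore] -/
theorem forall_card_mul_log_card_sub_one_le_sum_log_of_prime :
    ∀ S : Finset ℕ, (∀ p ∈ S, Nat.Prime p) →
      (S.card : ℝ) * (Real.log (S.card : ℝ) - 1) ≤ ∑ p ∈ S, Real.log (p : ℝ) :=
  fun _ hS => card_mul_log_card_sub_one_le_sum_log_of_prime hS

/-! ## 4. Radical language: `ω(n)·(log ω(n) − 1) ≤ log rad n ≤ log n` -/

/-- `ω(n)·(log ω(n) − 1) ≤ log rad(n)`, where `ω(n) = #(n.primeFactors)` and `rad n = ∏_{p ∣ n} p`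
(Mathlib `UniqueFactorizationMonoid.radical`, `Nat.radical_eq_prod_primeFactors`). [folklore] -/
theorem card_primeFactors_mul_log_sub_one_le_log_radical (n : ℕ) :
    (n.primeFactors.card : ℝ) * (Real.log (n.primeFactors.card : ℝ) - 1) ≤
      Real.log ((UniqueFactorizationMonoid.radical n : ℕ) : ℝ) := by
  have hS : ∀ p ∈ n.primeFactors, Nat.Prime p := fun p hp => Nat.prime_of_mem_primeFactors hp
  have h := card_mul_log_card_sub_one_le_sum_log_of_prime hS
  rw [Nat.radical_eq_prod_primeFactors, Nat.cast_prod, Real.log_prod]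
  · exact h
  · intro p hp
    exact_mod_cast (hS p hp).ne_zero

/-- `ω(n)·(log ω(n) − 1) ≤ log n` for `n ≠ 0` (since `rad n ≤ n`). [folklore] -/
theorem card_primeFactors_mul_log_sub_one_le_log {n : ℕ} (hn : n ≠ 0) :
    (n.primeFactors.card : ℝ) * (Real.log (n.primeFactors.card : ℝ) - 1) ≤ Real.log (n : ℝ) := by
  refine le_trans (card_primeFactors_mul_log_sub_one_le_log_radical n) ?_
  apply Real.log_le_log (by exact_mod_cast Nat.radical_pos n)
  exact_mod_cast Nat.radical_le_self_iff.mpr hn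

/-! ## 5. Monotonicity of `x ↦ x (log x − 1)` on `[1, ∞)` and the bound from a lower bound on `#S` -/

/-- `x ↦ x·(log x − 1)` is monotone on `[1, ∞)`: for `1 ≤ a ≤ b`, `a (log a − 1) ≤ b (log b − 1)`. Elementary:
`b log b − a log a = b·log(b/a) + (b − a)·log a ≥ b·(1 − a/b) + 0 = b − a` (`log y ≥ 1 − 1/y`). Literally the type of the
binder `hmono` of `windowEntryContentLaw_of`. [folklore] -/
theorem mul_log_sub_one_le_mul_log_sub_one {a b : ℝ} (ha : 1 ≤ a) (hab : a ≤ b) :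
    a * (Real.log a - 1) ≤ b * (Real.log b - 1) := by
  have ha0 : 0 < a := by linarith
  have hb0 : 0 < b := by linarith
  have hloga : 0 ≤ Real.log a := Real.log_nonneg ha
  have hq : 1 - (b / a)⁻¹ ≤ Real.log (b / a) := Real.one_sub_inv_le_log_of_pos (div_pos hb0 ha0)
  rw [inv_div, Real.log_div hb0.ne' ha0.ne'] at hq
  have h1 : b - a ≤ b * (Real.log b - Real.log a) := by
    have hm := mul_le_mul_of_nonneg_left hq hb0.le
    have e : b * (1 - a / b) = b - a := by field_simp
    linarith
  have h2 : 0 ≤ (b - a) * Real.log a := mul_nonneg (by linarith) hloga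
  nlinarith

/-- The `∀`-packaged monotonicity `∀ a b : ℝ, 1 ≤ a → a ≤ b → a * (Real.log a - 1) ≤ b * (Real.log b - 1)`. [folklore] -/
theorem forall_mul_log_sub_one_le_mul_log_sub_one :
    ∀ a b : ℝ, 1 ≤ a → a ≤ b → a * (Real.log a - 1) ≤ b * (Real.log b - 1) :=
  fun _ _ ha hab => mul_log_sub_one_le_mul_log_sub_one ha hab

/-- From a lower bound on the number of primes: if `1 ≤ m ≤ #S` for a finite set `S` of primes, then
`m·(log m − 1) ≤ Σ_{p ∈ S} log p`. [folklore] -/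
theorem mul_log_sub_one_le_sum_log_of_le_card {S : Finset ℕ} (hS : ∀ p ∈ S, Nat.Prime p) {m : ℝ} (hm : 1 ≤ m)
    (hmS : m ≤ (S.card : ℝ)) : m * (Real.log m - 1) ≤ ∑ p ∈ S, Real.log (p : ℝ) :=
  le_trans (mul_log_sub_one_le_mul_log_sub_one hm hmS) (card_mul_log_card_sub_one_le_sum_log_of_prime hS)

end Summit.ABC.IUTFork.Repair.RH.LogRadicalFloor
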